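import Summits.ABC.IUTFork.Repair.RHSigmaLicence
import Summits.ABC.IUTFork.Conditional.AbcOfSGenuineK
import Summits.ABC.IUTFork.Repair.RHHullThresholdExact
import HarnessLib

/-!
# R-H ROUND 2, Q2 (kernel target, row-specific half for the EQUIVALENCE rows 3/4/5): the strata Σ₄ (ν-cells = HullCell-POS) and Σ₃ ([ED]-cells)
# at the genuine bed `settingPrVolSharp (pilotDataOfK D K) …`, and «Cor. 3.12 up to the off-Σ remainder» AT EVERY GENUINE DATUM

abc-iut cell, rung LADDER-ABC:A2.RESCUE.H, R-H ROUND 2 seat abc-iut-rh2-q2-eq (21-frontier charge 2026-08-26T19:41:28Z Q2; rh-lead 19:48:27Z «rows 3/4/5: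
Σ = HullCell-POS / tame-ball strata»; signed ROUND-1 list 19:59:53Z: Σ₃ = the not-[ED]-refuted cells, Σ₄ = HullCell-POS = the exact U2 cell, Σ₅ =
tame/ball packets where the band holds). Companion of `RHSigmaLicence.lean` (generic: `LicenceOn`, `offRemainder`, `StatementUpTo`,
`statementUpTo_offRemainder_of_licenceOn`), which it instantiates; row 5 (tame-band licence) is abc-iut-rh-typ-5's `RHTameBandLicence(Ball)` and its
round-2 file, cited by name only.

§1 PER DATUM (any extension `L ⊇ F`, abc-iut-C-cert-3's vocabulary of `Conditional.GenuineK.cor312Of_of_SH`, p-ids of record there): **`GenuineK.cor312UpTo_of_licenceOn`**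
— realising side conditions + the licence ON A STRATUM `σ` + the one-sided Θ-identification ⟹ `I.negAbsLogQ ≤ I.negLogTheta + R_σ` (the datum's
Cor. 3.12 WEAKENED by the off-σ remainder of the setting); `…_of_pilotKummerCompatHullOn` (branch C's `hSHw`-shaped binder restricted to `σ`).
§2 ROW 4 (EQUIVALENCE ROW — the stratum is DISCHARGED, not assumed): **`NuCell`** = abc-iut-rp-d1's per-cell ν-criterion at `(j, p)` (abc-iut-rh-typ-4's
`HStarNu` is `∀ p j, NuCell p j`: `hStarNu_iff_forall_nuCell`), **`sigmaNu`** = Σ₄ := the cells whose ν-criterion holds; by rp-d1's EXACT per-cell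
criterion (`qRegion_subset_thetaHull_settingDHVolSharp_iff_exists_image`, p455685/p457117) **`sigmaNu_eq_licenceCells`** (Σ₄ IS the set of licence
cells; archimedean cells unconditional), hence **`licenceOn_sigmaNu`** («S restricted to Σ₄» is a THEOREM), **`statementUpTo_offRemainder_sigmaNu`**
(HYPOTHESIS-FREE: at the genuine bed with realising ideles the typed Cor. 3.12 holds up to `R_{Σ₄}`), `subset_sigmaNu_of_licenceOn` /
`offRemainder_sigmaNu_le` (Σ₄ is the LARGEST licence stratum, so `R_{Σ₄}` is the LEAST charge any honest Σ-restriction pays), `hStarNu_iff_sigmaNu_eq_univ`.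
§2b the B-SHIFT shape of abc-iut-rh2-xi-1's `RHOffSigmaTolerance` (p469145): `StatementUpTo P ε ⟹ ↑(−|log q| − ε) ≤ −|log Θ|` and back, so xi-1's
`cor312UpTo_of_weakStatement_of_links` / `gap_le_of_cor312UpTo` / `OffSigmaTolerance` consume every `StatementUpTo` BY NAME (the offRemainder ↔ D_off
bridge itself is abc-iut-rh-typ-12's `RHSigmaBudgetBridge`, p469317 — not restated).
SEQUEL `RHSigmaStrataEqDatum.lean`: row 4 AT THE GENUINE `K`-DATUM with all realising ideles and NO S_H (`GenuineK.cor312UpTo_sigmaNu`, the squeeze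
`gap ≤ δ + R_{Σ₄} + ((l+5)/4)·log π`), and row 3's stratum Σ₃ = the [ED]-cells of abc-iut-rh-typ-3's H⋆₃.

HONEST FRAMING: reading predicates and numbers about OUR typed objects (c312-7's sharp print-normalised setting, c312-5's packets with Dupuy–Hilado's
(Ind1)/(Ind2), the SHARP idele boxes); nothing here asserts that abc is proved or refuted, or that [IUTchIII] Cor. 3.12 holds or fails at any datum,
or takes a side on any author; `R_{Σ₄}` is DEFINED, not bounded, here; typed ≠ proved; refuted-as-typed ≠ refuted-in-print. [claim: Mochizuki2012,
status: disputed] for every IUT locution. [cite: Mochizuki2012, IUTchIII Cor. 3.12 p. 173–174, Step (xi-f) p. 184, Rmk. 3.9.5 (i) p. 127; IUTchI Ex. 3.2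
(iv) p. 71; IUTchIV Thm. 1.10 p. 23] [cite: DupuyHilado2025, §3.9, §4.12] [cite: ScholzeStix2018, §2.2 pp. 9–10]
-/

noncomputable section

open Set Function NumberField IsDedekindDomain
open scoped Pointwise

namespace Summit.ABC.IUTFork.Repair.RH.SigmaStrataEq

open Summit.ABC.IUTFork.Thm311 Summit.ABC.IUTFork.Thm311.Real Summit.ABC.IUTFork.Cor312 Summit.ABC.IUTFork.Cor312.Setting
  Summit.ABC.IUTFork.Cor312Vol Summit.ABC.IUTFork.Cor312Prov Literature.IUT.LogThetaLattice Literature.IUT.LogVolume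
  Literature.IUT.HodgeTheaters Literature.IUT.LogVolume.ThetaData
  Summit.ABC.IUTFork.Repair.RH.SigmaLicence Summit.ABC.IUTFork.Repair.RH.HullThresholdExact

/-! ## §1. Per datum over an extension `L ⊇ F`: the datum's Cor. 3.12 weakened by the off-σ remainder -/

section PerDatum

variable {F K Fbar : Type} [Field F] [NumberField F] [Field K] [NumberField K] [Algebra F K] [Field Fbar]
  [Algebra F Fbar] [Algebra K Fbar] {E : WeierstrassCurve F} [E.IsElliptic] {l : ℕ} {Pb : BadPlacePredicates K}
  (D : InitialThetaData F K Fbar E l Pb) {I : ThetaVolumeInput (fieldOfModuli E) K}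
  (L : Type) [Field L] [NumberField L] [Algebra F L] (M : Type) [Field M] [NumberField M]
  (archPk : ∀ (j : (thetaIndex (pilotDataOfK D L)).Label) (vQ : (thetaIndex (pilotDataOfK D L)).VQ), Set ((logShellsDH (pilotDataOfK D L) (analyticLogv L)).Packet j vQ))
  (archSub : ∀ (j : (thetaIndex (pilotDataOfK D L)).Label) (v : (thetaIndex (pilotDataOfK D L)).V),
    Set ((logShellsDH (pilotDataOfK D L) (analyticLogv L)).Packet j ((thetaIndex (pilotDataOfK D L)).over v)))
  (Ψ : ℤ → ∀ v : (thetaIndex (pilotDataOfK D L)).V, v ∈ (thetaIndex (pilotDataOfK D L)).Vbad → Set ((logShellsDH (pilotDataOfK D L) (analyticLogv L)).StarPacket v))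
  (act : ℤ → ∀ v : (thetaIndex (pilotDataOfK D L)).V, v ∈ (thetaIndex (pilotDataOfK D L)).Vbad →
    (logShellsDH (pilotDataOfK D L) (analyticLogv L)).StarPacket v → Module.End ℚ ((logShellsDH (pilotDataOfK D L) (analyticLogv L)).StarPacket v))
  (Mmod : ℤ → ∀ j : (thetaIndex (pilotDataOfK D L)).LabelStar, Set ((logShellsDH (pilotDataOfK D L) (analyticLogv L)).GlobalPacket j.1))
  (region : ℤ → ∀ j : (thetaIndex (pilotDataOfK D L)).LabelStar, FinDivisor M → ∀ vQ : (thetaIndex (pilotDataOfK D L)).VQ,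
    Set ((logShellsDH (pilotDataOfK D L) (analyticLogv L)).Packet j.1 vQ))
  (frobAdm : ℤ → ℤ → ∀ (j : (thetaIndex (pilotDataOfK D L)).Label) (vQ : (thetaIndex (pilotDataOfK D L)).VQ),
    Set ((logShellsDH (pilotDataOfK D L) (analyticLogv L)).Packet j vQ) → Prop)
  (frobLogvol : ℤ → ℤ → ∀ (j : (thetaIndex (pilotDataOfK D L)).Label) (vQ : (thetaIndex (pilotDataOfK D L)).VQ),
    Set ((logShellsDH (pilotDataOfK D L) (analyticLogv L)).Packet j vQ) → ℝ)
  (frobΨ : ℤ → ℤ → ∀ v : (thetaIndex (pilotDataOfK D L)).V, v ∈ (thetaIndex (pilotDataOfK D L)).Vbad → Set ((logShellsDH (pilotDataOfK D L) (analyticLogv L)).StarPacket v))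
  (frobMmod : ℤ → ℤ → ∀ j : (thetaIndex (pilotDataOfK D L)).LabelStar, Set ((logShellsDH (pilotDataOfK D L) (analyticLogv L)).GlobalPacket j.1))
  (unitImage : ℤ → ℤ → ℕ → ∀ (j : (thetaIndex (pilotDataOfK D L)).Label) (vQ : (thetaIndex (pilotDataOfK D L)).VQ),
    Set ((logShellsDH (pilotDataOfK D L) (analyticLogv L)).Packet j vQ))
  (ballImage : ℤ → ℤ → ∀ (j : (thetaIndex (pilotDataOfK D L)).Label) (vQ : (thetaIndex (pilotDataOfK D L)).VQ),
    Set ((logShellsDH (pilotDataOfK D L) (analyticLogv L)).Packet j vQ))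
  (thetaDiv : ℤ → ℤ → LgpDivisor M (thetaIndex (pilotDataOfK D L)).lstar)
  (n : ℤ) {HT : Type} {LogLink : HT → HT → Type} {IsFull : ∀ {s t : HT}, LogLink s t → Prop}
  (lat : LGPGaussianLogThetaLattice LogLink IsFull)
  {Frd : Type} {IsoF : Frd → Frd → Type} {Ob : Frd → Type} {realify : Frd → Frd} {Strip : Type}
  {IsoS : Strip → Strip → Type} {Mv : ∀ v : (thetaIndex (pilotDataOfK D L)).V, v ∈ (thetaIndex (pilotDataOfK D L)).Vbad → Type}
  [∀ v h, Monoid (Mv v h)]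
  (sig : GlobalLGPFrobenioidSignature (thetaIndex (pilotDataOfK D L)).lstar (thetaIndex (pilotDataOfK D L)).V (· ∈ (thetaIndex (pilotDataOfK D L)).Vbad)
    Frd IsoF Ob realify Strip IsoS Mv)
  (split : SplittingMonoids Mv) {ObΔ : Type} {N : ∀ v : (thetaIndex (pilotDataOfK D L)).V, v ∈ (thetaIndex (pilotDataOfK D L)).Vbad → Type}
  [∀ v h, Monoid (N v h)] (qData : QPilotData ObΔ N)
  (t : ∀ (pp : Nat.Primes) (_ : Fin (pilotDataOfK D L).lstar) (x : (thetaIndex (pilotDataOfK D L)).Fibre (.inr pp)),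
    haveI : Fact (pp : ℕ).Prime := ⟨pp.2⟩; kOf (pilotDataOfK D L) pp.1 x)
  (tq : ∀ (pp : Nat.Primes) (x : (thetaIndex (pilotDataOfK D L)).Fibre (.inr pp)), haveI : Fact (pp : ℕ).Prime := ⟨pp.2⟩; kOf (pilotDataOfK D L) pp.1 x)
  (ρ : (∀ v : (thetaIndex (pilotDataOfK D L)).V, v ∈ (thetaIndex (pilotDataOfK D L)).Vbad → Set ((logShellsDH (pilotDataOfK D L) (analyticLogv L)).StarPacket v)) →
    ∀ (j : (thetaIndex (pilotDataOfK D L)).Label) (vQ : (thetaIndex (pilotDataOfK D L)).VQ), Set ((logShellsDH (pilotDataOfK D L) (analyticLogv L)).Packet j vQ))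
  (qK : ∀ v : (thetaIndex (pilotDataOfK D L)).V, v ∈ (thetaIndex (pilotDataOfK D L)).Vbad → Set ((logShellsDH (pilotDataOfK D L) (analyticLogv L)).StarPacket v))

/-- **R-H ROUND 2 Q2 per datum: «S restricted to σ ⟹ the datum's Cor. 3.12 WEAKENED by the off-σ remainder».** One datum, genuine sharp
print-normalised setting OVER AN EXTENSION `L ⊇ F` at the constructed pilot datum `pilotDataOfK D L`, q- and Θ-ideles non-zero / units off `S`,
q-ideles REALISING `P_q`: the licence at the cells of `σ` (`LicenceOn`) and the one-sided Θ-identification `hΘ` give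
`I.negAbsLogQ ≤ I.negLogTheta + R_σ` for every genuine volume input `I` OF `D`. The q-number is DISCHARGED exactly as in abc-iut-C-cert-3's
`GenuineK.cor312Of_of_SH` (c312-7 `negLogQ_settingPrVolSharp` ∘ `absLogq_eq_ndeg_qPilot_pilotDataOfK` ∘ c312-8 `negAbsLogQ_eq_neg_absLogq_of_isVolumeInputOf`);
at `σ = univ` (`R = 0`) it IS that theorem. «follows AS TYPED»; no side taken. [claim: Mochizuki2012, status: disputed] -/
theorem GenuineK.cor312UpTo_of_licenceOn (hI : ThetaData.IsVolumeInputOf D I)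
    (htq0 : ∀ pp x, tq pp x ≠ 0)
    (htq1 : ∀ (pp : Nat.Primes) (x : (thetaIndex (pilotDataOfK D L)).Fibre (.inr pp)),
      haveI : Fact (pp : ℕ).Prime := ⟨pp.2⟩; placeOf (pilotDataOfK D L) pp.1 x ∉ (pilotDataOfK D L).S → ‖tq pp x‖ = 1)
    (ht0 : ∀ pp i x, t pp i x ≠ 0)
    (ht1 : ∀ (pp : Nat.Primes) (i : Fin (pilotDataOfK D L).lstar) (x : (thetaIndex (pilotDataOfK D L)).Fibre (.inr pp)),
      haveI : Fact (pp : ℕ).Prime := ⟨pp.2⟩; placeOf (pilotDataOfK D L) pp.1 x ∉ (pilotDataOfK D L).S → ‖t pp i x‖ = 1)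
    (htq : ∀ (pp : Nat.Primes) (x : (thetaIndex (pilotDataOfK D L)).Fibre (.inr pp)),
      haveI : Fact (pp : ℕ).Prime := ⟨pp.2⟩
      Real.log ‖tq pp x‖ = -((pilotDataOfK D L).qPilot (placeOf (pilotDataOfK D L) pp.1 x)) * logNorm L (placeOf (pilotDataOfK D L) pp.1 x) /
        localDegree L (placeOf (pilotDataOfK D L) pp.1 x))
    {σ : Set (Fin (thetaIndex (pilotDataOfK D L)).lstar × (thetaIndex (pilotDataOfK D L)).VQ)}
    (hσ : LicenceOn
      (settingPrVolSharp (pilotDataOfK D L) (logvAnalytic_analyticLogv (F := L)) M archPk archSub Ψ act Mmod region n lat sig split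
        qData tq t htq0 htq1) σ)
    (hΘ : (settingPrVolSharp (pilotDataOfK D L) (logvAnalytic_analyticLogv (F := L)) M archPk archSub Ψ act Mmod region n lat sig split
        qData tq t htq0 htq1).negLogTheta ≤
      ((I.negLogTheta : ℝ) : WithTop ℝ)) :
    I.negAbsLogQ ≤ I.negLogTheta +
      offRemainder
        (settingPrVolSharp (pilotDataOfK D L) (logvAnalytic_analyticLogv (F := L)) M archPk archSub Ψ act Mmod region n lat sig split
          qData tq t htq0 htq1) σ := by
  -- Step 1: the weakened Statement at the genuine setting over `L` — bridge hypotheses by abc-iut-w4-d128's capstone (no Thm 3.11 input)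
  have hst := statementUpTo_offRemainder_of_licenceOn
    (bridgeHyps_settingPrVolSharp_of_ideles (pilotDataOfK D L) (logvAnalytic_analyticLogv (F := L)) M archPk archSub Ψ act Mmod region n
      lat sig split qData t tq ht0 ht1 htq0 htq1) hσ
  -- Step 2: the q-side — `−|log(q)|` of the setting `= −deĝ_L(P_q(pilotDataOfK D L)) = −|log(q)|` of `D` `= I.negAbsLogQ`
  have hq := negLogQ_settingPrVolSharp (pilotDataOfK D L) (logvAnalytic_analyticLogv (F := L)) M archPk archSub Ψ act Mmod region n lat sig
    split qData t tq htq0 htq1 htq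
  rw [← absLogq_eq_ndeg_qPilot_pilotDataOfK D L] at hq
  obtain ⟨-, hle⟩ := hst
  rw [hq] at hle
  -- Step 3: the Θ-side by the one-sided identification `hΘ`
  rw [Cor312Prov.negAbsLogQ_eq_neg_absLogq_of_isVolumeInputOf D hI]
  have hle' := hle.trans (add_le_add hΘ le_rfl)
  rw [← WithTop.coe_add, WithTop.coe_le_coe] at hle'
  exact hle'

/-- **Branch C form** (the window certificates' `hSHw`-shaped binder RESTRICTED TO `σ`): realising side conditions + q-pin +
`PilotKummerCompatHullOn … σ` + `hΘ` ⟹ `I.negAbsLogQ ≤ I.negLogTheta + R_σ`. [claim: Mochizuki2012, status: disputed] -/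
theorem GenuineK.cor312UpTo_of_pilotKummerCompatHullOn (hI : ThetaData.IsVolumeInputOf D I)
    (htq0 : ∀ pp x, tq pp x ≠ 0)
    (htq1 : ∀ (pp : Nat.Primes) (x : (thetaIndex (pilotDataOfK D L)).Fibre (.inr pp)),
      haveI : Fact (pp : ℕ).Prime := ⟨pp.2⟩; placeOf (pilotDataOfK D L) pp.1 x ∉ (pilotDataOfK D L).S → ‖tq pp x‖ = 1)
    (ht0 : ∀ pp i x, t pp i x ≠ 0)
    (ht1 : ∀ (pp : Nat.Primes) (i : Fin (pilotDataOfK D L).lstar) (x : (thetaIndex (pilotDataOfK D L)).Fibre (.inr pp)),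
      haveI : Fact (pp : ℕ).Prime := ⟨pp.2⟩; placeOf (pilotDataOfK D L) pp.1 x ∉ (pilotDataOfK D L).S → ‖t pp i x‖ = 1)
    (htq : ∀ (pp : Nat.Primes) (x : (thetaIndex (pilotDataOfK D L)).Fibre (.inr pp)),
      haveI : Fact (pp : ℕ).Prime := ⟨pp.2⟩
      Real.log ‖tq pp x‖ = -((pilotDataOfK D L).qPilot (placeOf (pilotDataOfK D L) pp.1 x)) * logNorm L (placeOf (pilotDataOfK D L) pp.1 x) /
        localDegree L (placeOf (pilotDataOfK D L) pp.1 x))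
    {σ : Set (Fin (thetaIndex (pilotDataOfK D L)).lstar × (thetaIndex (pilotDataOfK D L)).VQ)}
    (hQPin : Cor312Vol.QPinned
      (LatticeSituation.ofShells (logShellsDH (pilotDataOfK D L) (analyticLogv L)) M archPk archSub
        (summandPiecesPr (pilotDataOfK D L) (logvAnalytic_analyticLogv (F := L))).Adm
        (summandPiecesPr (pilotDataOfK D L) (logvAnalytic_analyticLogv (F := L))).logvol Ψ act Mmod region frobAdm frobLogvol frobΨ
        frobMmod unitImage ballImage thetaDiv)
      (settingPrVolSharp (pilotDataOfK D L) (logvAnalytic_analyticLogv (F := L)) M archPk archSub Ψ act Mmod region n lat sig split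
        qData tq t htq0 htq1) ρ qK)
    (hSHσ : PilotKummerCompatHullOn
      (LatticeSituation.ofShells (logShellsDH (pilotDataOfK D L) (analyticLogv L)) M archPk archSub
        (summandPiecesPr (pilotDataOfK D L) (logvAnalytic_analyticLogv (F := L))).Adm
        (summandPiecesPr (pilotDataOfK D L) (logvAnalytic_analyticLogv (F := L))).logvol Ψ act Mmod region frobAdm frobLogvol frobΨ
        frobMmod unitImage ballImage thetaDiv)
      (settingPrVolSharp (pilotDataOfK D L) (logvAnalytic_analyticLogv (F := L)) M archPk archSub Ψ act Mmod region n lat sig split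
        qData tq t htq0 htq1) ρ qK σ)
    (hΘ : (settingPrVolSharp (pilotDataOfK D L) (logvAnalytic_analyticLogv (F := L)) M archPk archSub Ψ act Mmod region n lat sig split
        qData tq t htq0 htq1).negLogTheta ≤
      ((I.negLogTheta : ℝ) : WithTop ℝ)) :
    I.negAbsLogQ ≤ I.negLogTheta +
      offRemainder
        (settingPrVolSharp (pilotDataOfK D L) (logvAnalytic_analyticLogv (F := L)) M archPk archSub Ψ act Mmod region n lat sig split
          qData tq t htq0 htq1) σ :=
  GenuineK.cor312UpTo_of_licenceOn D L M archPk archSub Ψ act Mmod region n lat sig split qData t tq hI htq0 htq1 ht0 ht1 htq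
    ((pilotKummerCompatHullOn_iff_licenceOn hQPin σ).mp hSHσ) hΘ

end PerDatum

/-! ## §2. ROW 4: Σ₄ = the ν-cells (abc-iut-rp-d1's exact per-cell criterion) — the stratum IS the set of licence cells, so «S|Σ₄» is discharged -/

section RowFour

variable {F : Type} [Field F] [NumberField F] (X : PilotData F) {logv : PadicLogs F} (hlog : LogvAnalytic logv)
  (M : Type) [Field M] [NumberField M]
  (archPk : ∀ (j : (thetaIndex X).Label) (vQ : (thetaIndex X).VQ), Set ((logShellsDH X logv).Packet j vQ))
  (archSub : ∀ (j : (thetaIndex X).Label) (v : (thetaIndex X).V),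
    Set ((logShellsDH X logv).Packet j ((thetaIndex X).over v)))
  (Ψ : ℤ → ∀ v : (thetaIndex X).V, v ∈ (thetaIndex X).Vbad → Set ((logShellsDH X logv).StarPacket v))
  (act : ℤ → ∀ v : (thetaIndex X).V, v ∈ (thetaIndex X).Vbad →
    (logShellsDH X logv).StarPacket v → Module.End ℚ ((logShellsDH X logv).StarPacket v))
  (Mmod : ℤ → ∀ j : (thetaIndex X).LabelStar, Set ((logShellsDH X logv).GlobalPacket j.1))
  (region : ℤ → ∀ j : (thetaIndex X).LabelStar, FinDivisor M → ∀ vQ : (thetaIndex X).VQ,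
    Set ((logShellsDH X logv).Packet j.1 vQ))
  (n : ℤ) {HT : Type} {LogLink : HT → HT → Type} {IsFull : ∀ {s t : HT}, LogLink s t → Prop}
  (lat : LGPGaussianLogThetaLattice LogLink IsFull)
  {Frd : Type} {IsoF : Frd → Frd → Type} {Ob : Frd → Type} {realify : Frd → Frd} {Strip : Type}
  {IsoS : Strip → Strip → Type} {Mv : ∀ v : (thetaIndex X).V, v ∈ (thetaIndex X).Vbad → Type}
  [∀ v h, Monoid (Mv v h)]
  (sig : GlobalLGPFrobenioidSignature (thetaIndex X).lstar (thetaIndex X).V (· ∈ (thetaIndex X).Vbad)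
    Frd IsoF Ob realify Strip IsoS Mv)
  (split : SplittingMonoids Mv) {ObΔ : Type} {N : ∀ v : (thetaIndex X).V, v ∈ (thetaIndex X).Vbad → Type}
  [∀ v h, Monoid (N v h)] (qData : QPilotData ObΔ N)
  (tq : ∀ (pp : Nat.Primes) (x : (thetaIndex X).Fibre (.inr pp)), haveI : Fact (pp : ℕ).Prime := ⟨pp.2⟩; kOf X pp.1 x)
  (t : ∀ (pp : Nat.Primes) (_ : Fin X.lstar) (x : (thetaIndex X).Fibre (.inr pp)),
    haveI : Fact (pp : ℕ).Prime := ⟨pp.2⟩; kOf X pp.1 x)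
  (htq0 : ∀ pp x, tq pp x ≠ 0)
  (htq1 : ∀ (pp : Nat.Primes) (x : (thetaIndex X).Fibre (.inr pp)),
    haveI : Fact (pp : ℕ).Prime := ⟨pp.2⟩; placeOf X pp.1 x ∉ X.S → ‖tq pp x‖ = 1)

/-- **The ν-CELL at `(j, p)`** (abc-iut-rp-d1's per-cell reading of «‖t_q‖ ≤ ν_{j,p}(w)», `Cor312LicenceCellThreshold`; abc-iut-rh-typ-4's H⋆₄
`HStarNu` is its conjunction over all `(p, j)`): for every summand `v⃗` of the packet at `p` and every field factor `i`, SOME point of the union of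
the possible images at `(j, p)` dominates the q-idele of the last slot in the `(v⃗, i)`-coordinate. READING PREDICATE about OUR typed hull.
[claim: Mochizuki2012, status: disputed] -/
@[claim "Mochizuki2012" "disputed"]
def NuCell (pp : Nat.Primes) (j : (thetaIndex X).Label) : Prop :=
  haveI : Fact (pp : ℕ).Prime := ⟨pp.2⟩
  ∀ (e : (thetaIndex X).Caps j → (thetaIndex X).Fibre (.inr pp)) (i : DIdx (pp : ℕ) ((presAt X hlog pp).kk e)),
    ∃ z ∈ ⋃₀ (settingPrVolSharp X hlog M archPk archSub Ψ act Mmod region n lat sig split qData tq t htq0 htq1).possibleImages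
      j (.inr pp), ‖tq pp (e (Fin.last _))‖ ≤ ‖(presAt X hlog pp).factorMap j z ⟨e, i⟩‖

/-- **Σ₄ = `sigmaNu`, the ν-STRATUM (row 4 «HullCell-POS», the exact U2 cell, window-locator of record)**: the cells `(i, v_ℚ)` (label `j = i+1`)
such that at every prime `p` with `v_ℚ = p` the ν-cell holds (archimedean cells: no condition). [claim: Mochizuki2012, status: disputed] -/
@[claim "Mochizuki2012" "disputed"]
def sigmaNu : Set (Fin (thetaIndex X).lstar × (thetaIndex X).VQ) :=
  {c | ∀ pp : Nat.Primes, c.2 = .inr pp → NuCell X hlog M archPk archSub Ψ act Mmod region n lat sig split qData tq t htq0 htq1 pp (labelSucc c.1)}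

/-- abc-iut-rh-typ-4's H⋆₄ (`HStarNu`, p458452) IS «every ν-cell holds». [claim: Mochizuki2012, status: disputed] -/
theorem hStarNu_iff_forall_nuCell :
    HStarNu X hlog M archPk archSub Ψ act Mmod region n lat sig split qData tq t htq0 htq1 ↔
      ∀ (pp : Nat.Primes) (j : (thetaIndex X).Label),
        NuCell X hlog M archPk archSub Ψ act Mmod region n lat sig split qData tq t htq0 htq1 pp j :=
  Iff.rfl

/-- Archimedean cells are licence cells UNCONDITIONALLY (empty factor index: the comparison frame's one-way lemma with no coordinate to check).
[folklore] -/
theorem inl_mem_licenceCells (i : Fin (thetaIndex X).lstar) (u : Unit) :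
    (i, (Sum.inl u : (thetaIndex X).VQ)) ∈
      licenceCells (settingPrVolSharp X hlog M archPk archSub Ψ act Mmod region n lat sig split qData tq t htq0 htq1) := by
  show factorMapDH X hlog (labelSucc i) (.inl u) ⁻¹' hullSet (factorFieldDH X hlog (labelSucc i) (.inl u))
      (qCentreDH X hlog tq (labelSucc i) (.inl u)) ⊆
    (HullFrame.ofComparison (factorFieldDH X hlog (labelSucc i) (.inl u)) (factorMapDH X hlog (labelSucc i) (.inl u))).hull
      (⋃₀ (settingDHVolSharp X hlog M archPk archSub Ψ act Mmod region n lat sig split qData tq t htq0 htq1).possibleImages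
        (labelSucc i) (.inl u))
  exact HullFrame.preimage_hullSet_subset_hull_ofComparison _ _ _ _ fun s => s.elim

/-- **A prime cell `(i, p)` is a licence cell iff its ν-cell holds** — abc-iut-rp-d1's EXACT per-cell criterion
`qRegion_subset_thetaHull_settingDHVolSharp_iff_exists_image` (p455685; the two sharp settings share regions, frames and possible images).
[cite: Mochizuki2012, IUTchIII Rmk. 3.9.5 (i) p. 127] [claim: Mochizuki2012, status: disputed] -/
theorem inr_mem_licenceCells_iff (ht0 : ∀ pp i x, t pp i x ≠ 0) (i : Fin (thetaIndex X).lstar) (pp : Nat.Primes) :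
    (i, (Sum.inr pp : (thetaIndex X).VQ)) ∈
        licenceCells (settingPrVolSharp X hlog M archPk archSub Ψ act Mmod region n lat sig split qData tq t htq0 htq1) ↔
      NuCell X hlog M archPk archSub Ψ act Mmod region n lat sig split qData tq t htq0 htq1 pp (labelSucc i) :=
  qRegion_subset_thetaHull_settingDHVolSharp_iff_exists_image X hlog M archPk archSub Ψ act Mmod region n lat sig split qData tq t htq0
    htq1 ht0 pp (labelSucc i)

/-- **Σ₄ IS THE SET OF LICENCE CELLS** (Θ-ideles non-zero). [claim: Mochizuki2012, status: disputed] -/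
theorem sigmaNu_eq_licenceCells (ht0 : ∀ pp i x, t pp i x ≠ 0) :
    sigmaNu X hlog M archPk archSub Ψ act Mmod region n lat sig split qData tq t htq0 htq1 =
      licenceCells (settingPrVolSharp X hlog M archPk archSub Ψ act Mmod region n lat sig split qData tq t htq0 htq1) := by
  ext ⟨i, vQ⟩
  cases vQ with
  | inl u =>
    simp only [sigmaNu, Set.mem_setOf_eq, reduceCtorEq, false_implies, implies_true, true_iff]
    exact inl_mem_licenceCells X hlog M archPk archSub Ψ act Mmod region n lat sig split qData tq t htq0 htq1 i u
  | inr pp =>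
    refine Iff.trans ?_ (inr_mem_licenceCells_iff X hlog M archPk archSub Ψ act Mmod region n lat sig split qData tq t htq0 htq1 ht0 i pp).symm
    simp only [sigmaNu, Set.mem_setOf_eq]
    exact ⟨fun h => h pp rfl, fun h pp' hpp => by cases hpp; exact h⟩

/-- **«S RESTRICTED TO Σ₄» IS A THEOREM** (row 4 is an EQUIVALENCE row: the licence holds on the ν-stratum by definition of the stratum and
rp-d1's exact criterion). [claim: Mochizuki2012, status: disputed] -/
theorem licenceOn_sigmaNu (ht0 : ∀ pp i x, t pp i x ≠ 0) :
    LicenceOn (settingPrVolSharp X hlog M archPk archSub Ψ act Mmod region n lat sig split qData tq t htq0 htq1)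
      (sigmaNu X hlog M archPk archSub Ψ act Mmod region n lat sig split qData tq t htq0 htq1) := by
  rw [sigmaNu_eq_licenceCells X hlog M archPk archSub Ψ act Mmod region n lat sig split qData tq t htq0 htq1 ht0]
  exact licenceOn_licenceCells

/-- **Σ₄ is the LARGEST stratum carrying the licence**: any `σ` with `LicenceOn σ` lies inside Σ₄. [claim: Mochizuki2012, status: disputed] -/
theorem subset_sigmaNu_of_licenceOn (ht0 : ∀ pp i x, t pp i x ≠ 0)
    {σ : Set (Fin (thetaIndex X).lstar × (thetaIndex X).VQ)}
    (hσ : LicenceOn (settingPrVolSharp X hlog M archPk archSub Ψ act Mmod region n lat sig split qData tq t htq0 htq1) σ) :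
    σ ⊆ sigmaNu X hlog M archPk archSub Ψ act Mmod region n lat sig split qData tq t htq0 htq1 := by
  rw [sigmaNu_eq_licenceCells X hlog M archPk archSub Ψ act Mmod region n lat sig split qData tq t htq0 htq1 ht0]
  exact licenceOn_iff_subset_licenceCells.mp hσ

/-- H⋆₄ ⟹ Σ₄ is everything (then `R_{Σ₄} = 0` and the weakened statement is the printed one; H⋆₄ also constrains the label `0`, which no
cell of `𝔽_l^⋇` reads, so the converse is not claimed). [claim: Mochizuki2012, status: disputed] -/
theorem sigmaNu_eq_univ_of_hStarNu
    (h : HStarNu X hlog M archPk archSub Ψ act Mmod region n lat sig split qData tq t htq0 htq1) :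
    sigmaNu X hlog M archPk archSub Ψ act Mmod region n lat sig split qData tq t htq0 htq1 = Set.univ :=
  Set.eq_univ_of_forall fun c pp _ => h pp (labelSucc c.1)

/-- Under H⋆₄ the off-Σ₄ remainder vanishes. [claim: Mochizuki2012, status: disputed] -/
theorem offRemainder_sigmaNu_eq_zero_of_hStarNu
    (h : HStarNu X hlog M archPk archSub Ψ act Mmod region n lat sig split qData tq t htq0 htq1) :
    offRemainder (settingPrVolSharp X hlog M archPk archSub Ψ act Mmod region n lat sig split qData tq t htq0 htq1)
      (sigmaNu X hlog M archPk archSub Ψ act Mmod region n lat sig split qData tq t htq0 htq1) = 0 := by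
  rw [sigmaNu_eq_univ_of_hStarNu X hlog M archPk archSub Ψ act Mmod region n lat sig split qData tq t htq0 htq1 h]
  exact offRemainder_univ

/-- **ROW 4 KERNEL TARGET, HYPOTHESIS-FREE at the bed: the typed Cor. 3.12 holds UP TO `R_{Σ₄}`** at the sharp print-normalised setting of ANY
Dupuy–Hilado pilot datum with ideles non-zero and units off `S` (bridge hypotheses: abc-iut-w4-d128's capstone `bridgeHyps_settingPrVolSharp_of_ideles`).
No S_H, no H⋆: for the equivalence row «S restricted to Σ₄» is discharged and the ENTIRE content of Q2 is the size of `R_{Σ₄}`.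
[claim: Mochizuki2012, status: disputed] -/
theorem statementUpTo_offRemainder_sigmaNu (ht0 : ∀ pp i x, t pp i x ≠ 0)
    (ht1 : ∀ (pp : Nat.Primes) (i : Fin X.lstar) (x : (thetaIndex X).Fibre (.inr pp)),
      haveI : Fact (pp : ℕ).Prime := ⟨pp.2⟩; placeOf X pp.1 x ∉ X.S → ‖t pp i x‖ = 1) :
    StatementUpTo (settingPrVolSharp X hlog M archPk archSub Ψ act Mmod region n lat sig split qData tq t htq0 htq1)
      (offRemainder (settingPrVolSharp X hlog M archPk archSub Ψ act Mmod region n lat sig split qData tq t htq0 htq1)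
        (sigmaNu X hlog M archPk archSub Ψ act Mmod region n lat sig split qData tq t htq0 htq1)) :=
  statementUpTo_offRemainder_of_licenceOn
    (bridgeHyps_settingPrVolSharp_of_ideles X hlog M archPk archSub Ψ act Mmod region n lat sig split qData t tq ht0 ht1 htq0 htq1)
    (licenceOn_sigmaNu X hlog M archPk archSub Ψ act Mmod region n lat sig split qData tq t htq0 htq1 ht0)

/-- **`R_{Σ₄}` is the LEAST charge**: every stratum on which the licence holds pays at least `R_{Σ₄}` (antitonicity + maximality of Σ₄) — so the
hypothesis-free bound above is the best any «S restricted to Σ» row can deliver at this bed. [claim: Mochizuki2012, status: disputed] -/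
theorem offRemainder_sigmaNu_le (ht0 : ∀ pp i x, t pp i x ≠ 0)
    (ht1 : ∀ (pp : Nat.Primes) (i : Fin X.lstar) (x : (thetaIndex X).Fibre (.inr pp)),
      haveI : Fact (pp : ℕ).Prime := ⟨pp.2⟩; placeOf X pp.1 x ∉ X.S → ‖t pp i x‖ = 1)
    {σ : Set (Fin (thetaIndex X).lstar × (thetaIndex X).VQ)}
    (hσ : LicenceOn (settingPrVolSharp X hlog M archPk archSub Ψ act Mmod region n lat sig split qData tq t htq0 htq1) σ) :
    offRemainder (settingPrVolSharp X hlog M archPk archSub Ψ act Mmod region n lat sig split qData tq t htq0 htq1)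
        (sigmaNu X hlog M archPk archSub Ψ act Mmod region n lat sig split qData tq t htq0 htq1) ≤
      offRemainder (settingPrVolSharp X hlog M archPk archSub Ψ act Mmod region n lat sig split qData tq t htq0 htq1) σ :=
  offRemainder_anti
    (bridgeHyps_settingPrVolSharp_of_ideles X hlog M archPk archSub Ψ act Mmod region n lat sig split qData t tq ht0 ht1 htq0 htq1)
    (subset_sigmaNu_of_licenceOn X hlog M archPk archSub Ψ act Mmod region n lat sig split qData tq t htq0 htq1 ht0 hσ)

end RowFour

/-! ## §2b. The B-shift shape of abc-iut-rh2-xi-1's `RHOffSigmaTolerance` (p469145): `StatementUpTo P ε` ⟺ «`↑(−|log q| − ε) ≤ −|log Θ|`» -/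

section Shift

variable {T : ThetaIndex} {S : Situation T} {P : Cor312.Setting S}

/-- `StatementUpTo P ε` gives xi-1's weak-statement shape `↑(−|log(q)| − ε) ≤ −|log(Θ)|` (so `RH.OffSigma.cor312UpTo_of_weakStatement_of_links`,
`gap_le_of_cor312UpTo` and the tolerance predicate `OffSigmaTolerance` apply BY NAME to every `StatementUpTo` of this file and of
`RHSigmaLicence`). [claim: Mochizuki2012, status: disputed] -/
theorem negLogQ_sub_le_negLogTheta_of_statementUpTo {ε : ℝ} (h : StatementUpTo P ε) :
    ((P.negLogQ - ε : ℝ) : WithTop ℝ) ≤ P.negLogTheta := by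
  obtain ⟨hfin, hle⟩ := h
  obtain ⟨θ, hθ⟩ := WithTop.ne_top_iff_exists.mp hfin
  rw [← hθ] at hle ⊢
  rw [← WithTop.coe_add, WithTop.coe_le_coe] at hle
  exact WithTop.coe_le_coe.mpr (by linarith)

/-- Conversely, under `−|log(Θ)| ∈ ℝ` the B-shift shape gives `StatementUpTo`. [claim: Mochizuki2012, status: disputed] -/
theorem statementUpTo_of_negLogQ_sub_le_negLogTheta {ε : ℝ} (hfin : P.negLogTheta ≠ ⊤)
    (h : ((P.negLogQ - ε : ℝ) : WithTop ℝ) ≤ P.negLogTheta) : StatementUpTo P ε := by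
  refine ⟨hfin, ?_⟩
  obtain ⟨θ, hθ⟩ := WithTop.ne_top_iff_exists.mp hfin
  rw [← hθ] at h ⊢
  rw [← WithTop.coe_add, WithTop.coe_le_coe]
  have := WithTop.coe_le_coe.mp h
  linarith

end Shift

end Summit.ABC.IUTFork.Repair.RH.SigmaStrataEq

end
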